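import Mathlib
import Summits.Ventures.PercRepro.TriangleCapFourBandBase

/-!
# PercRepro — THE ROW `a = 4`, EVERY SUB-DIAGONAL `r`, EVERY DEGREE `≥ 4`: THE CONVEXITY BOUND (p3, gen 40;
part 156)

On the cell `m = 4 (k − 4) − r` (`k = r + 8 + j`) with every degree `≥ 4` the excesses `f(v) = d(v) − 4` sum to
`s = 2m − 4k = 2r + 4j` and are bounded by `M = k − 8 = r + j` (the max-degree lemma of part 154: `m ≥ 3k − 8`),
so `Σ f² ≤ M s = (r + j)(2r + 4j)`, below `mk − r(k − 1 − r) − 8s − 16k = 3r² + r + 6rj + 4j²` by `r² + r`.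
Hence `Σ_v d(v)² + r (k − 1 − r) ≤ m k` (`four_band_stability_of_min_degree`). Axioms: standard.
-/

namespace PercRepro

namespace TriangleCap

namespace C047

open Finset

variable {V : Type*} [Fintype V] [DecidableEq V]

omit [DecidableEq V] in
/-- `Σ_v f(v)² ≤ M · Σ_v f(v)` when every `f(v) ≤ M`. -/
theorem sum_sq_le_mul_sum (f : V → ℕ) (M : ℕ) (hM : ∀ v, f v ≤ M) :
    ∑ v, f v * f v ≤ M * ∑ v, f v := by
  rw [mul_sum]
  exact sum_le_sum (fun v _ => Nat.mul_le_mul_right _ (hM v))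

/-- **THE ROW `a = 4`, EVERY DEGREE `≥ 4`:** `K₄⁻`-free, `8 + r ≤ k`, `m + 16 + r = 4k`, every degree `≥ 4` ⇒
`Σ_v d(v)² + r (k − 1 − r) ≤ m k`. -/
theorem four_band_stability_of_min_degree (D : SimpleGraph V) [DecidableRel D.Adj] (hK : K4mFree D) (r : ℕ)
    (hk : 8 + r ≤ Fintype.card V) (hm : D.edgeFinset.card + 16 + r = 4 * Fintype.card V)
    (hdeg : ∀ z, 4 ≤ deg D z) :
    ∑ v, deg D v * deg D v + r * (Fintype.card V - 1 - r) ≤ D.edgeFinset.card * Fintype.card V := by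
  have hsum := sum_deg_eq D
  obtain ⟨f, hf⟩ : ∃ f : V → ℕ, ∀ v, deg D v = f v + 4 :=
    ⟨fun v => deg D v - 4, fun v => (Nat.sub_add_cancel (hdeg v)).symm⟩
  have e1 : ∑ v, deg D v = ∑ v, f v + 4 * Fintype.card V := by
    rw [sum_congr rfl (fun v _ => hf v), sum_add_distrib, sum_const, smul_eq_mul, card_univ]
    ring
  have e2 : ∀ v, deg D v * deg D v = f v * f v + 8 * f v + 16 := fun v => by rw [hf v]; ring
  have e3 : ∑ v, deg D v * deg D v = ∑ v, f v * f v + 8 * ∑ v, f v + 16 * Fintype.card V := by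
    rw [sum_congr rfl (fun v _ => e2 v), sum_add_distrib, sum_add_distrib, ← mul_sum, sum_const, smul_eq_mul,
      card_univ]
    ring
  -- the max-degree lemma: every excess is `≤ k − 8`
  have hM : ∀ v, f v + 8 ≤ Fintype.card V := by
    intro v
    have := deg_add_four_le_card_of_dense D hK (by omega) (by omega) v
    rw [hf v] at this
    omega
  have hA := sum_sq_le_mul_sum f (Fintype.card V - 8) (fun v => by have := hM v; omega)
  -- the arithmetic: `k = r + 8 + j`, `m = 3r + 16 + 4j`
  obtain ⟨j, hj⟩ : ∃ j, Fintype.card V = r + 8 + j := ⟨Fintype.card V - (r + 8), by omega⟩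
  have hmj : D.edgeFinset.card = 3 * r + 16 + 4 * j := by omega
  rw [e3, hmj, hj]
  have e4 : r + 8 + j - 1 - r = j + 7 := by omega
  rw [e4]
  have e5 : r + 8 + j - 8 = r + j := by omega
  rw [hj, e5] at hA
  rw [hj] at e1
  rw [hmj] at hsum
  have hs : ∑ v, f v = 2 * r + 4 * j := by omega
  rw [hs] at hA ⊢
  nlinarith

end C047

end TriangleCap

end PercRepro
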